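import Mathlib
import Literature.Probability.LatticeModels.ProdBernoulliIndependence
import Literature.Probability.LatticeModels.ProdBernoulliClusterLocality
import Literature.Probability.Percolation.PercolationProofs
import Literature.Probability.Percolation.PercolationEvents
import HarnessLib

/-!
# Crux `PercNearOneGluing.NearOneGluing` (stmt-CriticalPhenomena-4574) — stub `stub_lrfDepthOneTwo`

Line `SketchR2I5`, Cycle 3 (lead c3): the LEAST-RELIABLE-FIRST (LRF) gluing inequality at depth
one with two relays, the first proved instance (beyond Harris) of the LRF hitting rule
`μ(o ↔ A, o ↮ b) ≤ Σ_a μ(a* = a) · μ(a ↮ b)` (Cruxes/NearOneGluing/Ideas/lrf-hitting-rule.md);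
proves exactly the registered signature and lands with `--supports stmt-CriticalPhenomena-4574`.

Setting: the weighted complete graph on `Fin n`, `μ = prodBernoulli w` on bond configurations
`ω : Set (Sym2 (Fin n))`; the source `o` is joined with positive weight only to the relays
`a₁, a₂` (`w s(o, x) = 0` otherwise), `pᵢ := w s(o, aᵢ)`, and `a₁` is the LESS reliable relay
(`μ(a₂ ↮ b) ≤ μ(a₁ ↮ b)`).  Claim (`stub_lrfDepthOneTwo`):
`μ(o ↮ b, o ↔ {a₁, a₂}) ≤ p₁ μ(a₁ ↮ b) + (1 - p₁) p₂ μ(a₂ ↮ b)`.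

Proof.  Let `T = {e₁, e₂}`, `eᵢ := s(o, aᵢ)`, `G = openGraph ω`, `G' = openGraph (ω ∖ T)` and
`Cᵢ := {G'.Reachable aᵢ b}` ("`aᵢ ↔ b` avoiding the star of `o`"; determined by the pairs off
`T`).  Almost surely every weight-zero pair is closed, so every open pair at `o` is `e₁` or `e₂`
and `o` is isolated in `G'`; decomposing an open walk at its first pair of `T` gives a.s.
`o ↔ b ⟺ (e₁ open ∧ C₁) ∨ (e₂ open ∧ C₂)`, `o ↔ a₁ ∨ o ↔ a₂ ⟺ e₁ open ∨ e₂ open`,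
`a₁ ↔ b ⟺ C₁ ∨ (e₁, e₂ open ∧ C₂)` (and symmetrically).  With `g₁ := μ(C₁ᶜ ∩ C₂)`,
`g₂ := μ(C₂ᶜ ∩ C₁)`, `h₁₂ := μ(C₁ᶜ ∩ C₂ᶜ)`, `hᵢ := μ(Cᵢᶜ) = h₁₂ + gᵢ`, independence of `e₁`,
`e₂` and the pairs off `T` gives `μ(a₁ ↮ b) = h₁ - p₁p₂g₁`, `μ(a₂ ↮ b) = h₂ - p₂p₁g₂`,
`bad ≤ p₁p₂h₁₂ + p₁(1-p₂)h₁ + (1-p₁)p₂h₂`, and then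
`RHS - bound = p₁p₂(1-p₁)(g₁ - p₂g₂) ≥ 0`: the hypothesis reads `g₂(1 - p₁p₂) ≤ g₁(1 - p₁p₂)`,
so `g₂ ≤ g₁` unless `p₁ = 1`, and `p₂g₂ ≤ g₂`.
-/

namespace Summit.CriticalPhenomena.PercolationContinuityZ3.Theorems

open MeasureTheory Set Literature.Probability.LatticeModels Literature.Probability.Percolation
open scoped Classical BigOperators

namespace LrfDepthOneTwo

variable {n : ℕ}

/-! ### Open walks and the two star pairs -/

/-- First-`T`-pair decomposition of an open walk: an open walk from `u` to `v` either avoids the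
pairs of `T`, or it reaches, avoiding `T`, an endpoint `x` of an open pair `s(x, y) ∈ T` whose
other endpoint `y` is joined to `v`. [folklore] -/
theorem reachable_sdiff_or_exists {V : Type*} {ω : Set (Sym2 V)} (T : Set (Sym2 V)) {u v : V}
    (p : (openGraph ω).Walk u v) :
    (openGraph (ω \ T)).Reachable u v ∨
      ∃ x y, s(x, y) ∈ ω ∧ s(x, y) ∈ T ∧ x ≠ y ∧ (openGraph (ω \ T)).Reachable u x ∧
        (openGraph ω).Reachable y v := by
  induction p with
  | nil => exact Or.inl (SimpleGraph.Reachable.refl _)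
  | @cons u' x' v' hadj p ih =>
    obtain ⟨hmem, hne⟩ := (openGraph_adj ω u' x').1 hadj
    by_cases hS : s(u', x') ∈ T
    · exact Or.inr ⟨u', x', hmem, hS, hne, SimpleGraph.Reachable.refl _, ⟨p⟩⟩
    · have hadj' : (openGraph (ω \ T)).Adj u' x' := (openGraph_adj _ _ _).2 ⟨⟨hmem, hS⟩, hne⟩
      rcases ih with h | ⟨x, y, hxy, hxyT, hne', hux, hyv⟩
      · exact Or.inl (hadj'.reachable.trans h)
      · exact Or.inr ⟨x, y, hxy, hxyT, hne', hadj'.reachable.trans hux, hyv⟩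

section Config

variable {ω : Set (Sym2 (Fin n))} {o a₁ a₂ b : Fin n} {T : Set (Sym2 (Fin n))}

/-- If the open pairs at `o` are among `s(o, a₁)`, `s(o, a₂)` (the pairs of `T`), then `o` is
isolated in the open graph with `T` removed. [folklore] -/
theorem eq_of_reachable_sdiff (hT : ∀ e, e ∈ T ↔ e = s(o, a₁) ∨ e = s(o, a₂))
    (hZ : ∀ x : Fin n, x ≠ a₁ → x ≠ a₂ → x ≠ o → s(o, x) ∉ ω) {x : Fin n}
    (h : (openGraph (ω \ T)).Reachable o x) : x = o := by
  obtain ⟨p⟩ := h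
  cases p with
  | nil => rfl
  | cons hadj _ =>
    obtain ⟨⟨hmem, hS⟩, hne⟩ := (openGraph_adj _ _ _).1 hadj
    rw [hT, not_or] at hS
    exact absurd hmem (hZ _ (fun h => hS.1 (by rw [h])) (fun h => hS.2 (by rw [h])) (Ne.symm hne))

/-- An open path from `o` to another vertex starts with `s(o, a₁)` or `s(o, a₂)`. [folklore] -/
theorem mem_or_mem_of_reachable (hZ : ∀ x : Fin n, x ≠ a₁ → x ≠ a₂ → x ≠ o → s(o, x) ∉ ω)
    {a : Fin n} (hao : a ≠ o) (h : (openGraph ω).Reachable o a) :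
    s(o, a₁) ∈ ω ∨ s(o, a₂) ∈ ω := by
  obtain ⟨p⟩ := h
  cases p with
  | nil => exact absurd rfl hao
  | cons hadj _ =>
    obtain ⟨hmem, hne⟩ := (openGraph_adj ω _ _).1 hadj
    by_contra hno
    rw [not_or] at hno
    exact hZ _ (fun h => hno.1 (h ▸ hmem)) (fun h => hno.2 (h ▸ hmem)) (Ne.symm hne) hmem

/-- Decomposition of an open path from `u ≠ o` at its first pair of `T`: either it avoids `T`,
or `u` is joined avoiding `T` to a relay `aᵢ` whose star pair `s(o, aᵢ)` is open, and `o` is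
joined to the endpoint. [folklore] -/
theorem reach_cases (hT : ∀ e, e ∈ T ↔ e = s(o, a₁) ∨ e = s(o, a₂))
    (hZ : ∀ x : Fin n, x ≠ a₁ → x ≠ a₂ → x ≠ o → s(o, x) ∉ ω) {u v : Fin n} (huo : u ≠ o)
    (h : (openGraph ω).Reachable u v) :
    (openGraph (ω \ T)).Reachable u v ∨
      ((openGraph (ω \ T)).Reachable u a₁ ∧ s(o, a₁) ∈ ω ∧ (openGraph ω).Reachable o v) ∨
        ((openGraph (ω \ T)).Reachable u a₂ ∧ s(o, a₂) ∈ ω ∧ (openGraph ω).Reachable o v) := by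
  obtain ⟨p⟩ := h
  refine (reachable_sdiff_or_exists T p).imp_right ?_
  rintro ⟨x, y, hxy, hS, -, hux, hyv⟩
  have key : ∀ a : Fin n, s(x, y) = s(o, a) →
      (openGraph (ω \ T)).Reachable u a ∧ s(o, a) ∈ ω ∧ (openGraph ω).Reachable o v := by
    intro a ha
    rcases Sym2.eq_iff.1 ha with ⟨hx, hy⟩ | ⟨hx, hy⟩
    · have huo' : (openGraph (ω \ T)).Reachable u o := hx ▸ hux
      exact absurd (eq_of_reachable_sdiff hT hZ huo'.symm) huo
    · have hua : (openGraph (ω \ T)).Reachable u a := hx ▸ hux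
      have hov : (openGraph ω).Reachable o v := hy ▸ hyv
      exact ⟨hua, ha ▸ hxy, hov⟩
  exact ((hT _).1 hS).imp (key a₁) (key a₂)

/-- A.s. form of `{o ↔ b}` at depth one: `o ↔ b` iff some star pair `s(o, aᵢ)` is open and
`aᵢ ↔ b` avoiding the star. [folklore] -/
theorem reachable_target_iff (hT : ∀ e, e ∈ T ↔ e = s(o, a₁) ∨ e = s(o, a₂))
    (hZ : ∀ x : Fin n, x ≠ a₁ → x ≠ a₂ → x ≠ o → s(o, x) ∉ ω) (hoa₁ : o ≠ a₁) (hoa₂ : o ≠ a₂)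
    (hob : o ≠ b) :
    (openGraph ω).Reachable o b ↔
      (s(o, a₁) ∈ ω ∧ (openGraph (ω \ T)).Reachable a₁ b) ∨
        (s(o, a₂) ∈ ω ∧ (openGraph (ω \ T)).Reachable a₂ b) := by
  have hle : openGraph (ω \ T) ≤ openGraph ω := openGraph_mono Set.sdiff_subset
  constructor
  · intro h
    rcases reach_cases hT hZ hob.symm h.symm with h' | ⟨hr, he, -⟩ | ⟨hr, he, -⟩
    · exact absurd (eq_of_reachable_sdiff hT hZ h'.symm) hob.symm
    · exact Or.inl ⟨he, hr.symm⟩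
    · exact Or.inr ⟨he, hr.symm⟩
  · rintro (⟨he, hr⟩ | ⟨he, hr⟩)
    · exact ((openGraph_adj ω o a₁).2 ⟨he, hoa₁⟩).reachable.trans (hr.mono hle)
    · exact ((openGraph_adj ω o a₂).2 ⟨he, hoa₂⟩).reachable.trans (hr.mono hle)

/-- A.s. form of `{o ↔ a₁} ∪ {o ↔ a₂}` at depth one: some star pair is open. [folklore] -/
theorem reachable_relay_or_iff (hZ : ∀ x : Fin n, x ≠ a₁ → x ≠ a₂ → x ≠ o → s(o, x) ∉ ω)
    (hoa₁ : o ≠ a₁) (hoa₂ : o ≠ a₂) :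
    ((openGraph ω).Reachable o a₁ ∨ (openGraph ω).Reachable o a₂) ↔
      (s(o, a₁) ∈ ω ∨ s(o, a₂) ∈ ω) := by
  constructor
  · rintro (h | h)
    · exact mem_or_mem_of_reachable hZ hoa₁.symm h
    · exact mem_or_mem_of_reachable hZ hoa₂.symm h
  · rintro (h | h)
    · exact Or.inl ((openGraph_adj ω o a₁).2 ⟨h, hoa₁⟩).reachable
    · exact Or.inr ((openGraph_adj ω o a₂).2 ⟨h, hoa₂⟩).reachable

/-- A.s. form of `{a₁ ↔ b}` at depth one: `a₁ ↔ b` avoiding the star, or both star pairs are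
open and `a₂ ↔ b` avoiding the star. [folklore] -/
theorem reachable_relay_iff (hT : ∀ e, e ∈ T ↔ e = s(o, a₁) ∨ e = s(o, a₂))
    (hZ : ∀ x : Fin n, x ≠ a₁ → x ≠ a₂ → x ≠ o → s(o, x) ∉ ω) (hoa₁ : o ≠ a₁) (hoa₂ : o ≠ a₂)
    (hob : o ≠ b) :
    (openGraph ω).Reachable a₁ b ↔
      (openGraph (ω \ T)).Reachable a₁ b ∨
        (s(o, a₁) ∈ ω ∧ s(o, a₂) ∈ ω ∧ (openGraph (ω \ T)).Reachable a₂ b) := by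
  have hle : openGraph (ω \ T) ≤ openGraph ω := openGraph_mono Set.sdiff_subset
  constructor
  · intro h
    rcases reach_cases hT hZ hob.symm h.symm with h' | ⟨hr, -, -⟩ | ⟨hr₂, he₂, hoa⟩
    · exact Or.inl h'.symm
    · exact Or.inl hr.symm
    · rcases reach_cases hT hZ hoa₁.symm hoa.symm with h' | ⟨-, he₁, -⟩ | ⟨hr₁₂, -, -⟩
      · exact absurd (eq_of_reachable_sdiff hT hZ h'.symm) hoa₁.symm
      · exact Or.inr ⟨he₁, he₂, hr₂.symm⟩
      · exact Or.inl (hr₁₂.trans hr₂.symm)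
  · rintro (h | ⟨h₁, h₂, h⟩)
    · exact h.mono hle
    · exact ((openGraph_adj ω a₁ o).2 ⟨by rw [Sym2.eq_swap]; exact h₁, hoa₁.symm⟩).reachable.trans
        (((openGraph_adj ω o a₂).2 ⟨h₂, hoa₂⟩).reachable.trans (h.mono hle))

end Config

/-! ### Independence bookkeeping -/

/-- The event "`i` is open" is determined by the coordinate `i`. [folklore] -/
theorem detBy_mem (i : Sym2 (Fin n)) :
    DeterminedBy {ω : Set (Sym2 (Fin n)) | i ∈ ω} ({i} : Set (Sym2 (Fin n))) := by
  rw [determinedBy_iff]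
  intro ω ω' h
  simpa using Set.ext_iff.1 h i

/-- Complements of determined events are determined by the same coordinates. [folklore] -/
theorem detBy_compl {A : Set (Set (Sym2 (Fin n)))} {K : Set (Sym2 (Fin n))}
    (h : DeterminedBy A K) : DeterminedBy Aᶜ K := by
  rw [determinedBy_iff] at h ⊢
  intro ω ω' hω
  rw [Set.mem_compl_iff, Set.mem_compl_iff, h ω ω' hω]

/-- Connection in the open graph with the pairs of `T` removed is determined by the pairs off
`T`. [folklore] -/
theorem detBy_reachable_sdiff (T : Set (Sym2 (Fin n))) (x y : Fin n) :
    DeterminedBy {ω : Set (Sym2 (Fin n)) | (openGraph (ω \ T)).Reachable x y} Tᶜ := by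
  rw [determinedBy_iff]
  intro ω ω' h
  simp only [Set.mem_setOf_eq]
  rw [Set.sdiff_eq, Set.sdiff_eq, h]

/-- Under the product measure all weight-zero pairs are a.s. closed; in particular, at depth one,
a.s. every open pair at `o` goes to `a₁` or `a₂`. [folklore] -/
theorem ae_star (w : Sym2 (Fin n) → unitInterval) {o a₁ a₂ : Fin n}
    (hiso : ∀ x : Fin n, x ≠ a₁ → x ≠ a₂ → x ≠ o → w s(o, x) = 0) :
    ∀ᵐ ω ∂prodBernoulli w, ∀ x : Fin n, x ≠ a₁ → x ≠ a₂ → x ≠ o → s(o, x) ∉ ω := by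
  filter_upwards [prodBernoulli_ae_forall_notMem w
    (Set.toFinite {e : Sym2 (Fin n) | w e = 0}).countable (fun e he => he)] with ω hω x h₁ h₂ h₃
    using hω _ (hiso x h₁ h₂ h₃)

/-- Independence of two distinct coordinates `i ≠ j` from an event determined by the other
coordinates: `P(L₁ ∩ L₂ ∩ X) = P(L₁) P(L₂) P(X)` for `L₁` determined by `i`, `L₂` by `j` and
`X` by the complement of `T = {i, j}`. [folklore] -/
theorem real_inter_inter (w : Sym2 (Fin n) → unitInterval) {i j : Sym2 (Fin n)} (hij : i ≠ j)
    {T : Set (Sym2 (Fin n))} (hT : ∀ e, e ∈ T ↔ e = i ∨ e = j)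
    {L₁ L₂ X : Set (Set (Sym2 (Fin n)))} (h₁ : DeterminedBy L₁ ({i} : Set (Sym2 (Fin n))))
    (h₂ : DeterminedBy L₂ ({j} : Set (Sym2 (Fin n)))) (hX : DeterminedBy X Tᶜ) :
    (prodBernoulli w).real (L₁ ∩ L₂ ∩ X) =
      (prodBernoulli w).real L₁ * (prodBernoulli w).real L₂ * (prodBernoulli w).real X := by
  have hTF : (↑({i, j} : Finset (Sym2 (Fin n))) : Set (Sym2 (Fin n))) = T := by
    ext e
    simp [hT e]
  have hA : DeterminedBy (L₁ ∩ L₂) (↑({i, j} : Finset (Sym2 (Fin n))) : Set (Sym2 (Fin n))) := by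
    rw [hTF]
    exact (h₁.mono fun e he => (hT e).2 (Or.inl (Set.mem_singleton_iff.1 he))).inter
      (h₂.mono fun e he => (hT e).2 (Or.inr (Set.mem_singleton_iff.1 he)))
  have hB : DeterminedBy X (↑({i, j} : Finset (Sym2 (Fin n))) : Set (Sym2 (Fin n)))ᶜ := by
    rwa [hTF]
  have hA' : DeterminedBy L₁ (↑({i} : Finset (Sym2 (Fin n))) : Set (Sym2 (Fin n))) := by
    rwa [Finset.coe_singleton]
  have hB' : DeterminedBy L₂ (↑({i} : Finset (Sym2 (Fin n))) : Set (Sym2 (Fin n)))ᶜ := by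
    rw [Finset.coe_singleton]
    exact h₂.mono fun e he hi =>
      hij ((Set.mem_singleton_iff.1 hi).symm.trans (Set.mem_singleton_iff.1 he))
  rw [prodBernoulli_real_inter_of_determinedBy w _ hA hB MeasurableSet.of_discrete
      MeasurableSet.of_discrete,
    prodBernoulli_real_inter_of_determinedBy w _ hA' hB' MeasurableSet.of_discrete
      MeasurableSet.of_discrete]

/-- Total probability: `P(Aᶜ) = P(Aᶜ ∩ Bᶜ) + P(Aᶜ ∩ B)`. [folklore] -/
theorem real_compl_eq_add (w : Sym2 (Fin n) → unitInterval) (A B : Set (Set (Sym2 (Fin n)))) :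
    (prodBernoulli w).real Aᶜ =
      (prodBernoulli w).real (Aᶜ ∩ Bᶜ) + (prodBernoulli w).real (Aᶜ ∩ B) := by
  have h := measureReal_inter_add_sdiff (μ := prodBernoulli w) (s := Aᶜ) (t := Bᶜ)
    MeasurableSet.of_discrete
  rw [Set.sdiff_compl] at h
  exact h.symm

/-- Bookkeeping for a relay: `P(C₁ᶜ ∖ ({i, j open} ∩ C₁ᶜ ∩ C₂)) = P(C₁ᶜ) - w i · w j · P(C₁ᶜ ∩ C₂)`
for `C₁, C₂` determined by the pairs off `T = {i, j}`. [folklore] -/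
theorem real_sdiff_pattern (w : Sym2 (Fin n) → unitInterval) {i j : Sym2 (Fin n)} (hij : i ≠ j)
    {T : Set (Sym2 (Fin n))} (hT : ∀ e, e ∈ T ↔ e = i ∨ e = j)
    {C₁ C₂ : Set (Set (Sym2 (Fin n)))} (hC₁ : DeterminedBy C₁ Tᶜ) (hC₂ : DeterminedBy C₂ Tᶜ) :
    (prodBernoulli w).real (C₁ᶜ \ ({ω | i ∈ ω} ∩ {ω | j ∈ ω} ∩ (C₁ᶜ ∩ C₂))) =
      (prodBernoulli w).real C₁ᶜ - w i * w j * (prodBernoulli w).real (C₁ᶜ ∩ C₂) := by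
  rw [measureReal_sdiff (fun ω hω => hω.2.1) MeasurableSet.of_discrete,
    real_inter_inter w hij hT (detBy_mem i) (detBy_mem j) ((detBy_compl hC₁).inter hC₂),
    prodBernoulli_real_setOf_mem, prodBernoulli_real_setOf_mem]

/-- Bookkeeping for the bad event: the union bound over the three star patterns with an open
pair, each factorised by independence. [folklore] -/
theorem real_three_pieces_le (w : Sym2 (Fin n) → unitInterval) {i j : Sym2 (Fin n)} (hij : i ≠ j)
    {T : Set (Sym2 (Fin n))} (hT : ∀ e, e ∈ T ↔ e = i ∨ e = j)
    {C₁ C₂ : Set (Set (Sym2 (Fin n)))} (hC₁ : DeterminedBy C₁ Tᶜ) (hC₂ : DeterminedBy C₂ Tᶜ) :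
    (prodBernoulli w).real
        ({ω | i ∈ ω} ∩ {ω | j ∈ ω} ∩ (C₁ᶜ ∩ C₂ᶜ) ∪ {ω | i ∈ ω} ∩ {ω | j ∈ ω}ᶜ ∩ C₁ᶜ ∪
          {ω | i ∈ ω}ᶜ ∩ {ω | j ∈ ω} ∩ C₂ᶜ) ≤
      w i * w j * (prodBernoulli w).real (C₁ᶜ ∩ C₂ᶜ) +
        w i * (1 - w j) * (prodBernoulli w).real C₁ᶜ +
          (1 - w i) * w j * (prodBernoulli w).real C₂ᶜ := by
  refine ((measureReal_union_le _ _).trans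
    (add_le_add (measureReal_union_le _ _) le_rfl)).trans_eq ?_
  rw [real_inter_inter w hij hT (detBy_mem i) (detBy_mem j)
      ((detBy_compl hC₁).inter (detBy_compl hC₂)),
    real_inter_inter w hij hT (detBy_mem i) (detBy_compl (detBy_mem j)) (detBy_compl hC₁),
    real_inter_inter w hij hT (detBy_compl (detBy_mem i)) (detBy_mem j) (detBy_compl hC₂),
    Set.compl_setOf, Set.compl_setOf, prodBernoulli_real_setOf_mem, prodBernoulli_real_setOf_mem,
    prodBernoulli_real_setOf_notMem, prodBernoulli_real_setOf_notMem]

/-! ### The three a.s. identifications -/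

section Measure

variable (w : Sym2 (Fin n) → unitInterval) {o a₁ a₂ b : Fin n} {T : Set (Sym2 (Fin n))}

/-- `μ(a₁ ↮ b) = μ(C₁ᶜ ∖ ({e₁, e₂ open} ∩ C₁ᶜ ∩ C₂))` (a.s. identification of the events).
[folklore] -/
theorem real_compl_openConn_relay (hT : ∀ e, e ∈ T ↔ e = s(o, a₁) ∨ e = s(o, a₂))
    (hoa₁ : o ≠ a₁) (hoa₂ : o ≠ a₂) (hob : o ≠ b)
    (hiso : ∀ x : Fin n, x ≠ a₁ → x ≠ a₂ → x ≠ o → w s(o, x) = 0) :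
    (prodBernoulli w).real (openConn a₁ b)ᶜ =
      (prodBernoulli w).real ({ω | (openGraph (ω \ T)).Reachable a₁ b}ᶜ \
        ({ω | s(o, a₁) ∈ ω} ∩ {ω | s(o, a₂) ∈ ω} ∩
          ({ω | (openGraph (ω \ T)).Reachable a₁ b}ᶜ ∩
            {ω | (openGraph (ω \ T)).Reachable a₂ b}))) := by
  refine measureReal_congr (Filter.eventuallyEq_set.2 ?_)
  filter_upwards [ae_star w hiso] with ω hω
  simp only [Set.mem_compl_iff, Set.mem_sdiff, Set.mem_inter_iff, Set.mem_setOf_eq, openConn,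
    reachable_relay_iff hT hω hoa₁ hoa₂ hob]
  tauto

/-- `μ(o ↮ b, o ↔ {a₁, a₂}) = μ(⋃ of the three open star patterns with their avoiding events)`
(a.s. identification of the events). [folklore] -/
theorem real_bad_eq (hT : ∀ e, e ∈ T ↔ e = s(o, a₁) ∨ e = s(o, a₂))
    (hoa₁ : o ≠ a₁) (hoa₂ : o ≠ a₂) (hob : o ≠ b)
    (hiso : ∀ x : Fin n, x ≠ a₁ → x ≠ a₂ → x ≠ o → w s(o, x) = 0) :
    (prodBernoulli w).real ((openConn o b)ᶜ ∩ (openConn o a₁ ∪ openConn o a₂)) =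
      (prodBernoulli w).real
        ({ω | s(o, a₁) ∈ ω} ∩ {ω | s(o, a₂) ∈ ω} ∩
              ({ω | (openGraph (ω \ T)).Reachable a₁ b}ᶜ ∩
                {ω | (openGraph (ω \ T)).Reachable a₂ b}ᶜ) ∪
            {ω | s(o, a₁) ∈ ω} ∩ {ω | s(o, a₂) ∈ ω}ᶜ ∩
              {ω | (openGraph (ω \ T)).Reachable a₁ b}ᶜ ∪
          {ω | s(o, a₁) ∈ ω}ᶜ ∩ {ω | s(o, a₂) ∈ ω} ∩
            {ω | (openGraph (ω \ T)).Reachable a₂ b}ᶜ) := by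
  refine measureReal_congr (Filter.eventuallyEq_set.2 ?_)
  filter_upwards [ae_star w hiso] with ω hω
  simp only [Set.mem_inter_iff, Set.mem_union, Set.mem_compl_iff, Set.mem_setOf_eq, openConn,
    reachable_target_iff hT hω hoa₁ hoa₂ hob, reachable_relay_or_iff hω hoa₁ hoa₂]
  tauto

end Measure

/-- The final algebra: with `u₁ = h₁ - p₁p₂g₁`, `u₂ = h₂ - p₂p₁g₂`, `hᵢ = h₁₂ + gᵢ`,
`bad ≤ p₁p₂h₁₂ + p₁(1-p₂)h₁ + (1-p₁)p₂h₂` and `u₂ ≤ u₁`, one has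
`bad ≤ p₁u₁ + (1-p₁)p₂u₂` (slack `p₁p₂(1-p₁)(g₁ - p₂g₂) ≥ 0`). [folklore] -/
theorem algebra {p₁ p₂ g₁ g₂ h₁ h₂ h₁₂ h₂₁ u₁ u₂ bad : ℝ} (hp₁ : 0 ≤ p₁) (hp₁' : p₁ ≤ 1)
    (hp₂ : 0 ≤ p₂) (hp₂' : p₂ ≤ 1) (hg₂ : 0 ≤ g₂)
    (hu₁ : u₁ = h₁ - p₁ * p₂ * g₁) (hu₂ : u₂ = h₂ - p₂ * p₁ * g₂)
    (hbad : bad ≤ p₁ * p₂ * h₁₂ + p₁ * (1 - p₂) * h₁ + (1 - p₁) * p₂ * h₂)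
    (hh₁ : h₁ = h₁₂ + g₁) (hh₂ : h₂ = h₂₁ + g₂) (hcomm : h₂₁ = h₁₂) (hrel : u₂ ≤ u₁) :
    bad ≤ p₁ * u₁ + (1 - p₁) * p₂ * u₂ := by
  subst hu₁ hu₂ hh₁ hh₂ hcomm
  have key : 0 ≤ (1 - p₁) * (g₁ - p₂ * g₂) := by
    rcases hp₁'.eq_or_lt with h | h
    · rw [h, sub_self, zero_mul]
    · have h12 : p₁ * p₂ < 1 := (mul_le_of_le_one_right hp₁ hp₂').trans_lt h
      have hg : g₂ ≤ g₁ := by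
        by_contra hcon
        have : 0 < (g₂ - g₁) * (1 - p₁ * p₂) := mul_pos (by linarith) (by linarith)
        nlinarith
      have : p₂ * g₂ ≤ g₂ := mul_le_of_le_one_left hg₂ hp₂'
      exact mul_nonneg (by linarith) (by linarith)
  nlinarith [mul_nonneg (mul_nonneg hp₁ hp₂) key]

end LrfDepthOneTwo

open LrfDepthOneTwo in
/-- **LRF gluing at depth one, two relays** (least-reliable-first hitting rule, first proved case
beyond Harris; new, not in Kozma–Nitzan arXiv:2401.12397).  Let `o` be joined only to the relays
`a₁, a₂` (`w s(o, x) = 0` otherwise), `pᵢ = w s(o, aᵢ)`, and let `a₁` be the LESS reliable relay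
(`μ(a₂ ↮ b) ≤ μ(a₁ ↮ b)`).  Then
`μ(o ↮ b, o ↔ {a₁, a₂}) ≤ p₁ · μ(a₁ ↮ b) + (1 − p₁) p₂ · μ(a₂ ↮ b)`
(`= Σ_a μ(a* = a) μ(a ↮ b)` for the rule probing `a₁` first). -/
theorem stub_lrfDepthOneTwo :
    ∀ (n : ℕ) (w : Sym2 (Fin n) → unitInterval) (o a₁ a₂ b : Fin n),
      o ≠ a₁ → o ≠ a₂ → o ≠ b → a₁ ≠ a₂ →
      (∀ x : Fin n, x ≠ a₁ → x ≠ a₂ → x ≠ o → w s(o, x) = 0) →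
      (prodBernoulli w).real (openConn a₂ b)ᶜ ≤ (prodBernoulli w).real (openConn a₁ b)ᶜ →
      (prodBernoulli w).real ((openConn o b)ᶜ ∩ (openConn o a₁ ∪ openConn o a₂)) ≤
        (w s(o, a₁) : ℝ) * (prodBernoulli w).real (openConn a₁ b)ᶜ +
          (1 - (w s(o, a₁) : ℝ)) * (w s(o, a₂) : ℝ) * (prodBernoulli w).real (openConn a₂ b)ᶜ := by
  intro n w o a₁ a₂ b hoa₁ hoa₂ hob ha₁₂ hiso hrel
  have he : s(o, a₁) ≠ s(o, a₂) := fun h => ha₁₂ (Sym2.congr_right.1 h)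
  have hT : ∀ e, e ∈ ({s(o, a₁), s(o, a₂)} : Set (Sym2 (Fin n))) ↔ e = s(o, a₁) ∨ e = s(o, a₂) :=
    fun e => by simp
  have hT' : ∀ e, e ∈ ({s(o, a₁), s(o, a₂)} : Set (Sym2 (Fin n))) ↔ e = s(o, a₂) ∨ e = s(o, a₁) :=
    fun e => (hT e).trans or_comm
  have hiso' : ∀ x : Fin n, x ≠ a₂ → x ≠ a₁ → x ≠ o → w s(o, x) = 0 :=
    fun x h₂ h₁ h₃ => hiso x h₁ h₂ h₃
  have hd₁ := detBy_reachable_sdiff ({s(o, a₁), s(o, a₂)} : Set (Sym2 (Fin n))) a₁ b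
  have hd₂ := detBy_reachable_sdiff ({s(o, a₁), s(o, a₂)} : Set (Sym2 (Fin n))) a₂ b
  have hu₁ := (real_compl_openConn_relay w hT hoa₁ hoa₂ hob hiso).trans
    (real_sdiff_pattern w he hT hd₁ hd₂)
  have hu₂ := (real_compl_openConn_relay w hT' hoa₂ hoa₁ hob hiso').trans
    (real_sdiff_pattern w he.symm hT' hd₂ hd₁)
  have hbad := (real_bad_eq w hT hoa₁ hoa₂ hob hiso).trans_le
    (real_three_pieces_le w he hT hd₁ hd₂)
  exact algebra (w _).2.1 (w _).2.2 (w _).2.1 (w _).2.2 measureReal_nonneg hu₁ hu₂ hbad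
    (real_compl_eq_add w _ _) (real_compl_eq_add w _ _) (by rw [Set.inter_comm]) hrel

end Summit.CriticalPhenomena.PercolationContinuityZ3.Theorems
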